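import Mathlib

/-!
# Route `FilamentSkeletonRss` · child crux `TangentSkeletonNearStraightL` (stmt-NavierStokesRegularity-23320) · registered line
# `child_tangent_analytic_strip_L` (b0b56c52900dd90a), stub `stub_stripPropagation` — brick for R4: SEGMENT INTEGRALS VIA PRIMITIVES (CAUCHY FOR POLYGONS IN A BALL)

The contour of the quarter-width blueprint (evidence `QUARTER-CONTOUR-CERTIFICATES-leafhand-15-g1.md` on 23320) is a target-anchored TENT with
SLOPED descents, so the rectangle-only Cauchy theorem used by the `/16` build (`Theorems.StadiumContourFreeze`) does not move it.  The replacement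
is elementary: Mathlib gives PRIMITIVES of holomorphic vector-valued maps on balls (`DifferentiableOn.isExactOn_ball`, Morera on a disc), and a
segment integral is a difference of primitive values.  This file records exactly that, for a complete normed `ℂ`-space `E`:
* `hasDerivAt_affine_path` — `t ↦ p + t(q − p)` has derivative `q − p`;
* `segment_integral_eq_sub` — if `Φ′ = f` on an open set containing the segment `[p, q]` and `f` is continuous there, then
  `∫₀¹ (q − p) • f(p + t(q − p)) dt = Φ q − Φ p`;
* `segment_integral_triangle_ball`, `segment_integral_quad_ball` — for `f` holomorphic on a ball containing the vertices, the segment integrals along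
  `p → q → s` equal the one along `p → s` (and the four-vertex version): contour independence for polygonal paths inside a ball, which is what the
  freeze step of the tent needs (each move of a vertex happens inside a small ball on which the kernel is holomorphic by the pointwise certificates).
HONEST FRAMING: generic complex analysis serving a plan about a HYPOTHETICAL filament skeleton on the NEGATIVE side of a MODEL route; the stub
`stub_stripPropagation` is NOT closed by this file; nothing here bears on Navier–Stokes regularity or blow-up.  `--supports stmt-NavierStokesRegularity-23320`.
-/

set_option linter.dupNamespace false

noncomputable section

namespace Summit.NavierStokesRegularity.NavierStokesRegularity.Theorems.StadiumSegmentPrimitive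

open Set Metric MeasureTheory

variable {E : Type*} [NormedAddCommGroup E] [NormedSpace ℂ E] [CompleteSpace E]

/-- The affine path `t ↦ p + t(q − p)` has derivative `q − p`. [folklore] -/
theorem hasDerivAt_affine_path (p q : ℂ) (t : ℝ) :
    HasDerivAt (fun t : ℝ => p + (t : ℂ) * (q - p)) (q - p) t := by
  have h1 : HasDerivAt (fun t : ℝ => (t : ℂ)) 1 t := by
    simpa using (hasDerivAt_id t).ofReal_comp
  have h2 := (h1.mul_const (q - p)).const_add p
  simpa using h2

/-- The affine path stays in a convex set containing its endpoints. [folklore] -/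
theorem affine_path_mem {U : Set ℂ} (hU : Convex ℝ U) {p q : ℂ} (hp : p ∈ U) (hq : q ∈ U) {t : ℝ} (ht : t ∈ Icc (0:ℝ) 1) :
    p + (t : ℂ) * (q - p) ∈ U := by
  have h := hU hp hq (by linarith [ht.2] : (0:ℝ) ≤ 1 - t) ht.1 (by ring)
  have e : (1 - t) • p + t • q = p + (t : ℂ) * (q - p) := by
    simp only [Complex.real_smul]
    push_cast
    ring
  rw [e] at h
  exact h

/-- **A segment integral is a difference of primitive values.**  `U` open, `Φ′ = f` on `U`, `f` continuous on `U`, the segment `[p,q] ⊆ U`: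
`∫₀¹ (q − p) • f(p + t(q − p)) dt = Φ q − Φ p`. [folklore] -/
theorem segment_integral_eq_sub {U : Set ℂ} {f Φ : ℂ → E} (hΦ : ∀ w ∈ U, HasDerivAt Φ (f w) w)
    (hf : ContinuousOn f U) {p q : ℂ} (hseg : ∀ t ∈ Icc (0:ℝ) 1, p + (t : ℂ) * (q - p) ∈ U) :
    ∫ t in (0:ℝ)..1, (q - p) • f (p + (t : ℂ) * (q - p)) = Φ q - Φ p := by
  have hderiv : ∀ t ∈ uIcc (0:ℝ) 1,
      HasDerivAt (fun t : ℝ => Φ (p + (t : ℂ) * (q - p))) ((q - p) • f (p + (t : ℂ) * (q - p))) t := by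
    intro t ht
    rw [uIcc_of_le zero_le_one] at ht
    have hγ := hasDerivAt_affine_path p q t
    have hΦ' := hΦ _ (hseg t ht)
    exact hΦ'.scomp t hγ
  have hcont : ContinuousOn (fun t : ℝ => (q - p) • f (p + (t : ℂ) * (q - p))) (uIcc (0:ℝ) 1) := by
    rw [uIcc_of_le zero_le_one]
    refine continuousOn_const.smul (hf.comp ?_ fun t ht => hseg t ht)
    exact (continuous_const.add (Complex.continuous_ofReal.mul continuous_const)).continuousOn
  have h := intervalIntegral.integral_eq_sub_of_hasDerivAt hderiv hcont.intervalIntegrable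
  simpa using h

/-- **Cauchy for a triangle in a ball.**  `f` holomorphic on `ball c r`, vertices `p, q, s` in the ball:
`∫₀¹ (q−p)•f(p+t(q−p)) + ∫₀¹ (s−q)•f(q+t(s−q)) = ∫₀¹ (s−p)•f(p+t(s−p))`. [folklore] -/
theorem segment_integral_triangle_ball {f : ℂ → E} {c : ℂ} {r : ℝ} (hf : DifferentiableOn ℂ f (ball c r))
    {p q s : ℂ} (hp : p ∈ ball c r) (hq : q ∈ ball c r) (hs : s ∈ ball c r) :
    (∫ t in (0:ℝ)..1, (q - p) • f (p + (t : ℂ) * (q - p))) + (∫ t in (0:ℝ)..1, (s - q) • f (q + (t : ℂ) * (s - q))) =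
      ∫ t in (0:ℝ)..1, (s - p) • f (p + (t : ℂ) * (s - p)) := by
  obtain ⟨Φ, hΦ⟩ := hf.isExactOn_ball
  have hfc : ContinuousOn f (ball c r) := hf.continuousOn
  have hconv : Convex ℝ (ball c r) := convex_ball c r
  rw [segment_integral_eq_sub hΦ hfc (fun t ht => affine_path_mem hconv hp hq ht),
    segment_integral_eq_sub hΦ hfc (fun t ht => affine_path_mem hconv hq hs ht),
    segment_integral_eq_sub hΦ hfc (fun t ht => affine_path_mem hconv hp hs ht)]
  abel

/-- **Cauchy for a quadrilateral in a ball**: `p → q → s → u` integrates like `p → u`. [folklore] -/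
theorem segment_integral_quad_ball {f : ℂ → E} {c : ℂ} {r : ℝ} (hf : DifferentiableOn ℂ f (ball c r))
    {p q s u : ℂ} (hp : p ∈ ball c r) (hq : q ∈ ball c r) (hs : s ∈ ball c r) (hu : u ∈ ball c r) :
    (∫ t in (0:ℝ)..1, (q - p) • f (p + (t : ℂ) * (q - p))) + (∫ t in (0:ℝ)..1, (s - q) • f (q + (t : ℂ) * (s - q))) +
        (∫ t in (0:ℝ)..1, (u - s) • f (s + (t : ℂ) * (u - s))) =
      ∫ t in (0:ℝ)..1, (u - p) • f (p + (t : ℂ) * (u - p)) := by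
  rw [segment_integral_triangle_ball hf hp hq hs, segment_integral_triangle_ball hf hp hs hu]

/-- **Reversal**: the segment integral from `q` to `p` is minus the one from `p` to `q` (inside a ball of holomorphy). [folklore] -/
theorem segment_integral_reverse_ball {f : ℂ → E} {c : ℂ} {r : ℝ} (hf : DifferentiableOn ℂ f (ball c r))
    {p q : ℂ} (hp : p ∈ ball c r) (hq : q ∈ ball c r) :
    ∫ t in (0:ℝ)..1, (p - q) • f (q + (t : ℂ) * (p - q)) = -∫ t in (0:ℝ)..1, (q - p) • f (p + (t : ℂ) * (q - p)) := by
  have h := segment_integral_triangle_ball hf hp hq hp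
  have h0 : ∫ t in (0:ℝ)..1, (p - p) • f (p + (t : ℂ) * (p - p)) = 0 := by simp
  rw [h0] at h
  exact eq_neg_of_add_eq_zero_right h

end Summit.NavierStokesRegularity.NavierStokesRegularity.Theorems.StadiumSegmentPrimitive

end
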